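import Mathlib
import Literature.MathematicalPhysics.StatisticalMechanics.MiePotential
import Literature.Barriers.AtomisticToContinuum.LocalizedPotentialsExcludeLennardJones
import Summits.AtomisticToContinuum.Crystallization.Theorems.ThreeConeCertificateExactCertificateTransfer1DClass

/-!
# Crux `ExactCertificate` (stmt-AtomisticToContinuum-11959), line `closure-makes-nogap-exact`:
# TRANSFER V — the INSTANCES of the class theorem: every Mie chain crystallizes energetically

Support file (`--supports stmt-AtomisticToContinuum-11959`); nothing here closes the 3-D crux.  The class
theorems of `…Transfer1DClass.lean` (exact three-cone certificate, sharp Kepler bound, periodic minimality,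
`HasPeriodicGroundStateEnergy V 1` for every one-crossing Laplace-class potential at every zero-pressure
spacing) are instantiated at the MIE FAMILY `mieWith A B n m = A r⁻ⁿ − B r⁻ᵐ` (`A, B > 0`, naturals
`n > m ≥ 3`; tree def of `Literature/Barriers/AtomisticToContinuum/LocalizedPotentialsExcludeLennardJones.lean`):

* `mie_laplace` — `A r⁻ⁿ − B r⁻ᵐ = −∫₀^∞ e^{−tr} p(t) dt` with `p(t) = B t^{m−1}/(m−1)! − A t^{n−1}/(n−1)!`;
* `mie_density_sign` — ONE sign change, at `t₀^{n−m} = B (n−1)!/(A (m−1)!)`;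
* `mie_density_envelope` — `|p(t)| ≤ (B/(m−1)! + A/(n−1)!)(t² + t^{n−1})` (uses `m ≥ 3`);
* `mie_zeroPressure_exists` — the zero-pressure spacing `a^{n−m} = A n ζ(n)/(B m ζ(m))` (closed form);
* `mie_oneCrossingData` — the bundle of class hypotheses;
* **`stub_mieChain`** (registered) — `HasPeriodicGroundStateEnergy (mieWith A B n m) 1` for all `A, B > 0`,
  `n > m ≥ 3`; `exactCertificate_mie_one`, `keplerBound_mie_one` — the crux `ExactCertificate` and the route's
  `KeplerBound` VERBATIM with `3 ↦ 1`, `lennardJones ↦ mieWith A B n m`;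
* `hasPeriodicGroundStateEnergy_miePotential_one` — the normalised Mie `(2p, p)` potentials of
  `MiePotential.lean` (`p ≥ 3`); at `p = 6` (`miePotential_six : miePotential 6 = lennardJones`) this is c6's
  `hasPeriodicGroundStateEnergy_lennardJones_one`, recovered as an instance of the class (not restated here).

Internally the exponents are written `m = j + 1`, `n = j + d + 1` (`j ≥ 2`, `d ≥ 1`) to avoid truncated
subtraction.  All `[folklore]`.
-/

noncomputable section

namespace Summit.AtomisticToContinuum.Crystallization.Theorems.ThreeConeCertificateExactCertificate.Transfer1D

open Literature.MathematicalPhysics.StatisticalMechanics MeasureTheory Set Filter Topology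
open scoped BigOperators Nat
open Literature.Barriers.AtomisticToContinuum (mieWith mieWith_apply)

/-! ## The Laplace density of a Mie potential -/

/-- **Laplace representation of the Mie potential**: for `r > 0`,
`A r^{−(i+1)} − B r^{−(j+1)} = −∫₀^∞ e^{−tr} (B tʲ/j! − A tⁱ/i!) dt` (Euler's integral). [folklore] -/
theorem mie_laplace (A B : ℝ) (i j : ℕ) {r : ℝ} (hr : 0 < r) :
    mieWith A B (i + 1) (j + 1) r =
      -(∫ t in Set.Ioi (0 : ℝ), Real.exp (-(t * r)) * (B * t ^ j / (j !) - A * t ^ i / (i !))) := by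
  have hi := integrableOn_exp_neg_mul_mul_pow i hr
  have hj := integrableOn_exp_neg_mul_mul_pow j hr
  have e : ∀ t : ℝ, Real.exp (-(t * r)) * (B * t ^ j / (j !) - A * t ^ i / (i !)) =
      B / (j !) * (Real.exp (-(t * r)) * t ^ j) - A / (i !) * (Real.exp (-(t * r)) * t ^ i) := fun t => by
    ring
  simp_rw [e]
  rw [integral_sub (hj.const_mul _) (hi.const_mul _), integral_const_mul, integral_const_mul,
    integral_exp_neg_mul_mul_pow j hr, integral_exp_neg_mul_mul_pow i hr, mieWith_apply]
  have hj0 : (((j !) : ℕ) : ℝ) ≠ 0 := by positivity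
  have hi0 : (((i !) : ℕ) : ℝ) ≠ 0 := by positivity
  have hr0 : r ≠ 0 := hr.ne'
  rw [inv_pow, inv_pow]
  field_simp
  ring

/-- **The weighted first moment**: for `b > 0`,
`∫₀^∞ e^{−tb} (B tʲ/j! − A tⁱ/i!) t dt = B (j+1) b^{−(j+2)} − A (i+1) b^{−(i+2)}`. [folklore] -/
theorem mie_moment (A B : ℝ) (i j : ℕ) {b : ℝ} (hb : 0 < b) :
    ∫ t in Set.Ioi (0 : ℝ), Real.exp (-(t * b)) * (B * t ^ j / (j !) - A * t ^ i / (i !)) * t =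
      B * ((j : ℝ) + 1) * b⁻¹ ^ (j + 2) - A * ((i : ℝ) + 1) * b⁻¹ ^ (i + 2) := by
  have hi := integrableOn_exp_neg_mul_mul_pow (i + 1) hb
  have hj := integrableOn_exp_neg_mul_mul_pow (j + 1) hb
  have e : ∀ t : ℝ, Real.exp (-(t * b)) * (B * t ^ j / (j !) - A * t ^ i / (i !)) * t =
      B / (j !) * (Real.exp (-(t * b)) * t ^ (j + 1)) - A / (i !) * (Real.exp (-(t * b)) * t ^ (i + 1)) :=
    fun t => by ring
  simp_rw [e]
  rw [integral_sub (hj.const_mul _) (hi.const_mul _), integral_const_mul, integral_const_mul,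
    integral_exp_neg_mul_mul_pow (j + 1) hb, integral_exp_neg_mul_mul_pow (i + 1) hb,
    Nat.factorial_succ j, Nat.factorial_succ i]
  push_cast
  have hj0 : (((j !) : ℕ) : ℝ) ≠ 0 := by positivity
  have hi0 : (((i !) : ℕ) : ℝ) ≠ 0 := by positivity
  have hb0 : b ≠ 0 := hb.ne'
  rw [inv_pow, inv_pow]
  field_simp

/-- **One sign change.**  For `A, B > 0` and `d ≥ 1` the density `B tʲ/j! − A t^{j+d}/(j+d)!` is `≥ 0` on
`(0, t₀]` and `≤ 0` on `[t₀, ∞)`, where `t₀^d = B (j+d)!/(A j!)`. [folklore] -/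
theorem mie_density_sign {A B : ℝ} (hA : 0 < A) (hB : 0 < B) (j d : ℕ) (hd : 1 ≤ d) :
    ∃ t₀ : ℝ, 0 < t₀ ∧
      (∀ t : ℝ, 0 < t → t ≤ t₀ → 0 ≤ B * t ^ j / (j !) - A * t ^ (j + d) / ((j + d) !)) ∧
      (∀ t : ℝ, t₀ ≤ t → B * t ^ j / (j !) - A * t ^ (j + d) / ((j + d) !) ≤ 0) := by
  set T : ℝ := B * ((j + d) !) / (A * (j !)) with hT
  have hTpos : 0 < T := by positivity
  have hd0 : (d : ℝ) ≠ 0 := by exact_mod_cast (show d ≠ 0 by omega)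
  have ht0pos : 0 < T ^ (1 / (d : ℝ)) := Real.rpow_pos_of_pos hTpos _
  have ht0d : (T ^ (1 / (d : ℝ))) ^ d = T := by
    rw [← Real.rpow_natCast, ← Real.rpow_mul hTpos.le, one_div_mul_cancel hd0, Real.rpow_one]
  have key : ∀ t : ℝ, B * t ^ j / (j !) - A * t ^ (j + d) / ((j + d) !) =
      A / ((j + d) !) * t ^ j * (T - t ^ d) := by
    intro t
    have hj0 : (((j !) : ℕ) : ℝ) ≠ 0 := by positivity
    have hjd0 : ((((j + d) !) : ℕ) : ℝ) ≠ 0 := by positivity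
    rw [hT, pow_add]
    field_simp
  refine ⟨T ^ (1 / (d : ℝ)), ht0pos, fun t ht htle => ?_, fun t hle => ?_⟩
  · rw [key]
    have h1 : t ^ d ≤ T := by rw [← ht0d]; exact pow_le_pow_left₀ ht.le htle d
    exact mul_nonneg (by positivity) (sub_nonneg.2 h1)
  · rw [key]
    have ht : 0 < t := ht0pos.trans_le hle
    have h1 : T ≤ t ^ d := by rw [← ht0d]; exact pow_le_pow_left₀ ht0pos.le hle d
    exact mul_nonpos_of_nonneg_of_nonpos (by positivity) (sub_nonpos.2 h1)

/-- **The envelope** (`j ≥ 2`): `|B tʲ/j! − A t^{j+d}/(j+d)!| ≤ (B/j! + A/(j+d)!)(t² + t^{j+d})` for `t > 0`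
(`tʲ ≤ t²` on `(0,1]`, `tʲ ≤ t^{j+d}` on `[1,∞)`). [folklore] -/
theorem mie_density_envelope {A B : ℝ} (hA : 0 ≤ A) (hB : 0 ≤ B) (j d : ℕ) (hj : 2 ≤ j) {t : ℝ}
    (ht : 0 < t) :
    |B * t ^ j / (j !) - A * t ^ (j + d) / ((j + d) !)| ≤ (B / (j !) + A / ((j + d) !)) * (t ^ 2 + t ^ (j + d)) := by
  have h1 : t ^ j ≤ t ^ 2 + t ^ (j + d) := by
    rcases le_total t 1 with h | h
    · have : t ^ j ≤ t ^ 2 := pow_le_pow_of_le_one ht.le h hj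
      linarith [pow_nonneg ht.le (j + d)]
    · have : t ^ j ≤ t ^ (j + d) := pow_le_pow_right₀ h (by omega)
      nlinarith [pow_nonneg ht.le 2]
  have h2 : t ^ (j + d) ≤ t ^ 2 + t ^ (j + d) := by linarith [pow_nonneg ht.le 2]
  have hBj : 0 ≤ B / (j !) := by positivity
  have hAi : 0 ≤ A / ((j + d) !) := by positivity
  calc |B * t ^ j / (j !) - A * t ^ (j + d) / ((j + d) !)|
      ≤ |B * t ^ j / (j !)| + |A * t ^ (j + d) / ((j + d) !)| := abs_sub _ _
    _ = B / (j !) * t ^ j + A / ((j + d) !) * t ^ (j + d) := by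
        rw [abs_of_nonneg (by positivity), abs_of_nonneg (by positivity)]; ring
    _ ≤ B / (j !) * (t ^ 2 + t ^ (j + d)) + A / ((j + d) !) * (t ^ 2 + t ^ (j + d)) :=
        add_le_add (mul_le_mul_of_nonneg_left h1 hBj) (mul_le_mul_of_nonneg_left h2 hAi)
    _ = (B / (j !) + A / ((j + d) !)) * (t ^ 2 + t ^ (j + d)) := by ring

/-! ## Zero pressure in closed form -/

/-- **The zero-pressure spacing of a Mie chain.**  For `A, B > 0`, `j, d ≥ 1` there is `a > 0` — namely
`a^d = A (j+d+1) ζ(j+d+1) / (B (j+1) ζ(j+1))` — at which the `(k+1)`-weighted first moments of the Mie density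
sum to zero: `Σ_k (k+1)[B(j+1)((k+1)a)^{−(j+2)} − A(j+d+1)((k+1)a)^{−(j+d+2)}] = 0`. [folklore] -/
theorem mie_zeroPressure_exists {A B : ℝ} (hA : 0 < A) (hB : 0 < B) (j d : ℕ) (hj : 1 ≤ j) (hd : 1 ≤ d) :
    ∃ a : ℝ, 0 < a ∧ HasSum (fun k : ℕ => ((k : ℝ) + 1) *
      ∫ t in Set.Ioi (0 : ℝ), Real.exp (-(t * (((k : ℝ) + 1) * a))) *
        (B * t ^ j / (j !) - A * t ^ (j + d) / ((j + d) !)) * t) 0 := by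
  -- the two zeta values
  have hs1 : Summable (fun k : ℕ => ((k : ℝ) + 1)⁻¹ ^ (j + 1)) := classBounds_summable_inv_pow (by omega)
  have hs2 : Summable (fun k : ℕ => ((k : ℝ) + 1)⁻¹ ^ (j + d + 1)) :=
    classBounds_summable_inv_pow (by omega)
  set Z1 : ℝ := ∑' k : ℕ, ((k : ℝ) + 1)⁻¹ ^ (j + 1) with hZ1
  set Z2 : ℝ := ∑' k : ℕ, ((k : ℝ) + 1)⁻¹ ^ (j + d + 1) with hZ2
  have hZ1pos : 0 < Z1 := by
    refine lt_of_lt_of_le (by positivity : (0 : ℝ) < ((((0 : ℕ) : ℝ) + 1)⁻¹ ^ (j + 1))) ?_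
    exact le_hasSum hs1.hasSum 0 fun k _ => by positivity
  have hZ2pos : 0 < Z2 := by
    refine lt_of_lt_of_le (by positivity : (0 : ℝ) < ((((0 : ℕ) : ℝ) + 1)⁻¹ ^ (j + d + 1))) ?_
    exact le_hasSum hs2.hasSum 0 fun k _ => by positivity
  -- the spacing `a`, `a^d = S`
  set S : ℝ := A * ((j : ℝ) + d + 1) * Z2 / (B * ((j : ℝ) + 1) * Z1) with hS
  have hSpos : 0 < S := by positivity
  have hd0 : (d : ℝ) ≠ 0 := by exact_mod_cast (show d ≠ 0 by omega)
  set a : ℝ := S ^ (1 / (d : ℝ)) with ha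
  have hapos : 0 < a := Real.rpow_pos_of_pos hSpos _
  have had : a ^ d = S := by
    rw [ha, ← Real.rpow_natCast, ← Real.rpow_mul hSpos.le, one_div_mul_cancel hd0, Real.rpow_one]
  refine ⟨a, hapos, ?_⟩
  -- termwise closed form
  have hterm : ∀ k : ℕ, ((k : ℝ) + 1) *
      (∫ t in Set.Ioi (0 : ℝ), Real.exp (-(t * (((k : ℝ) + 1) * a))) *
        (B * t ^ j / (j !) - A * t ^ (j + d) / ((j + d) !)) * t)
      = B * ((j : ℝ) + 1) * a⁻¹ ^ (j + 2) * ((k : ℝ) + 1)⁻¹ ^ (j + 1)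
        - A * ((j : ℝ) + d + 1) * a⁻¹ ^ (j + d + 2) * ((k : ℝ) + 1)⁻¹ ^ (j + d + 1) := by
    intro k
    have hk : (k : ℝ) + 1 ≠ 0 := by positivity
    have hane : a ≠ 0 := hapos.ne'
    have hb : 0 < ((k : ℝ) + 1) * a := by positivity
    rw [mie_moment A B (j + d) j hb]
    push_cast
    rw [mul_inv, mul_pow, mul_pow, pow_succ (((k : ℝ) + 1)⁻¹) (j + 1),
      show j + d + 2 = (j + d + 1) + 1 by ring, pow_succ (((k : ℝ) + 1)⁻¹) (j + d + 1)]
    field_simp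
  have hsum : HasSum (fun k : ℕ => B * ((j : ℝ) + 1) * a⁻¹ ^ (j + 2) * ((k : ℝ) + 1)⁻¹ ^ (j + 1)
      - A * ((j : ℝ) + d + 1) * a⁻¹ ^ (j + d + 2) * ((k : ℝ) + 1)⁻¹ ^ (j + d + 1))
      (B * ((j : ℝ) + 1) * a⁻¹ ^ (j + 2) * Z1 - A * ((j : ℝ) + d + 1) * a⁻¹ ^ (j + d + 2) * Z2) :=
    (hs1.hasSum.mul_left _).sub (hs2.hasSum.mul_left _)
  have hval : B * ((j : ℝ) + 1) * a⁻¹ ^ (j + 2) * Z1 - A * ((j : ℝ) + d + 1) * a⁻¹ ^ (j + d + 2) * Z2 = 0 := by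
    have hane : a ≠ 0 := hapos.ne'
    have hZ1ne : Z1 ≠ 0 := hZ1pos.ne'
    -- `a⁻¹^(j+2) = a^d · a⁻¹^(j+d+2)`
    have e1 : a⁻¹ ^ (j + 2) = a ^ d * a⁻¹ ^ (j + d + 2) := by
      rw [show j + d + 2 = (j + 2) + d by ring, pow_add, inv_pow, inv_pow, inv_pow]
      field_simp
      ring
    have e2 : A * ((j : ℝ) + d + 1) * Z2 = S * (B * ((j : ℝ) + 1) * Z1) := by
      rw [hS]; field_simp
    rw [e1, had]
    calc B * ((j : ℝ) + 1) * (S * a⁻¹ ^ (j + d + 2)) * Z1 - A * ((j : ℝ) + d + 1) * a⁻¹ ^ (j + d + 2) * Z2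
        = a⁻¹ ^ (j + d + 2) * (S * (B * ((j : ℝ) + 1) * Z1) - A * ((j : ℝ) + d + 1) * Z2) := by ring
      _ = 0 := by rw [e2, sub_self, mul_zero]
  rw [hval] at hsum
  simpa only [hterm] using hsum

/-! ## The class data of a Mie potential and the instances -/

/-- **Mie potentials are in the one-crossing Laplace class and admit a zero-pressure spacing**: for `A, B > 0`
and naturals `n > m ≥ 3`, the bundle of hypotheses of the class theorems of `…Transfer1DClass.lean` holds for
`V = mieWith A B n m` (density `B t^{m−1}/(m−1)! − A t^{n−1}/(n−1)!`, `M = n − 1`). [folklore] -/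
theorem mie_oneCrossingData {A B : ℝ} (hA : 0 < A) (hB : 0 < B) {n m : ℕ} (hm : 3 ≤ m) (hmn : m < n) :
    ∃ (p : ℝ → ℝ) (t₀ C a : ℝ) (M : ℕ), Measurable p ∧ 0 < t₀ ∧
      (∀ t : ℝ, 0 < t → t ≤ t₀ → 0 ≤ p t) ∧ (∀ t : ℝ, t₀ ≤ t → p t ≤ 0) ∧ 2 ≤ M ∧
      (∀ t : ℝ, 0 < t → |p t| ≤ C * (t ^ 2 + t ^ M)) ∧
      (∀ r : ℝ, 0 < r → mieWith A B n m r = -(∫ t in Set.Ioi (0 : ℝ), Real.exp (-(t * r)) * p t)) ∧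
      0 < a ∧
      HasSum (fun k : ℕ => ((k : ℝ) + 1) *
        ∫ t in Set.Ioi (0 : ℝ), Real.exp (-(t * (((k : ℝ) + 1) * a))) * p t * t) 0 := by
  obtain ⟨j, rfl⟩ : ∃ j, m = j + 1 := ⟨m - 1, by omega⟩
  obtain ⟨d, rfl⟩ : ∃ d, n = j + d + 1 := ⟨n - j - 1, by omega⟩
  obtain ⟨t₀, ht₀, hpos, hneg⟩ := mie_density_sign hA hB j d (by omega)
  obtain ⟨a, ha, hz⟩ := mie_zeroPressure_exists hA hB j d (by omega) (by omega)
  have hpm : Measurable (fun t : ℝ => B * t ^ j / (j !) - A * t ^ (j + d) / ((j + d) !)) := by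
    fun_prop
  exact ⟨fun t => B * t ^ j / (j !) - A * t ^ (j + d) / ((j + d) !), t₀, B / (j !) + A / ((j + d) !), a, j + d,
    hpm, ht₀, hpos, hneg, by omega, fun t ht => mie_density_envelope hA.le hB.le j d (by omega) ht,
    fun r hr => mie_laplace A B (j + d) j hr, ha, hz⟩

/-- **Registered stub `stub_mieChain` — ENERGETIC CRYSTALLIZATION OF EVERY MIE CHAIN**: for all `A, B > 0` and
naturals `n > m ≥ 3`, `HasPeriodicGroundStateEnergy (A r⁻ⁿ − B r⁻ᵐ) 1` — the ground-state energy per particle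
of `N` Mie particles on a line converges to the minimum of the energy per particle over all periodic
configurations of `ℝ¹`, attained at the zero-pressure chain `a^{n−m} = A n ζ(n)/(B m ζ(m))` (conjunct (i) of
the summit sub-problem with `3 ↦ 1`, `lennardJones ↦ mieWith A B n m`). [folklore] -/
theorem stub_mieChain : ∀ (A B : ℝ) (n m : ℕ), 0 < A → 0 < B → 3 ≤ m → m < n →
    HasPeriodicGroundStateEnergy (Literature.Barriers.AtomisticToContinuum.mieWith A B n m) 1 := by
  intro A B n m hA hB hm hmn
  obtain ⟨p, t₀, C, a, M, hpm, ht₀, hpos, hneg, hM, hbd, hV, ha, hz⟩ := mie_oneCrossingData hA hB hm hmn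
  exact hasPeriodicGroundStateEnergy_one_of_oneCrossing hpm ht₀ hpos hneg hM hbd hV ha hz

/-- **The exact three-cone certificate of a Mie chain**: the crux `ExactCertificate` VERBATIM with `3 ↦ 1` and
`lennardJones ↦ mieWith A B n m` (`A, B > 0`, `n > m ≥ 3`). [folklore] -/
theorem exactCertificate_mie_one {A B : ℝ} (hA : 0 < A) (hB : 0 < B) {n m : ℕ} (hm : 3 ≤ m) (hmn : m < n) :
    ∃ (P : PeriodicConfiguration 1) (ρ c : ℝ) (g U f : ℝ → ℝ),
      (∀ r : ℝ, 0 < r → mieWith A B n m r = g r + U r + f r) ∧ (∀ r : ℝ, 0 < r → 0 ≤ U r) ∧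
      (∀ r : ℝ, ρ ≤ r → g r = 0) ∧
      (∀ (n : ℕ) (y : Fin n → EuclideanSpace ℝ (Fin 1)) (w : Fin n → ℝ),
        0 ≤ ∑ i, ∑ j, w i * w j * f (dist (y i) (y j))) ∧
      (∀ (N : ℕ) (x : Fin N → EuclideanSpace ℝ (Fin 1)), Function.Injective x →
        -(c * (N : ℝ)) ≤ interactionEnergy g x) ∧
      c + f 0 / 2 = -(P.energyPerParticle (mieWith A B n m)) := by
  obtain ⟨p, t₀, C, a, M, hpm, ht₀, hpos, hneg, hM, hbd, hV, ha, hz⟩ := mie_oneCrossingData hA hB hm hmn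
  exact exactCertificate_one_of_oneCrossing hpm ht₀ hpos hneg hM hbd hV ha hz

/-- **The sharp Kepler bound of a Mie chain**: the route's `KeplerBound` VERBATIM with `3 ↦ 1` and
`lennardJones ↦ mieWith A B n m` (`A, B > 0`, `n > m ≥ 3`) — some periodic configuration of the line (the
zero-pressure chain) has `N·e(P) ≤ E(x)` for every configuration of `N` distinct points. [folklore] -/
theorem keplerBound_mie_one {A B : ℝ} (hA : 0 < A) (hB : 0 < B) {n m : ℕ} (hm : 3 ≤ m) (hmn : m < n) :
    ∃ P : PeriodicConfiguration 1, ∀ (N : ℕ) (x : Fin N → EuclideanSpace ℝ (Fin 1)), Function.Injective x →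
      (N : ℝ) * P.energyPerParticle (mieWith A B n m) ≤ interactionEnergy (mieWith A B n m) x := by
  obtain ⟨p, t₀, C, a, M, hpm, ht₀, hpos, hneg, hM, hbd, hV, ha, hz⟩ := mie_oneCrossingData hA hB hm hmn
  obtain ⟨-, P, -, -, hP, -⟩ := oneCrossing_magic hpm ht₀ hpos hneg hM hbd hV ha hz
  exact ⟨P, fun N x hx => hP ▸ keplerBound_one_of_oneCrossing hpm ht₀ hpos hneg hM hbd hV ha hz N x hx⟩

/-- The normalised Mie `(2p, p)` potential of `MiePotential.lean` is `mieWith (1/(2p)) (1/p) (2p) p`.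
[folklore] -/
theorem miePotential_eq_mieWith (p : ℕ) : miePotential p = mieWith (1 / (2 * (p : ℝ))) (1 / (p : ℝ)) (2 * p) p := by
  funext r
  rw [miePotential_apply, mieWith_apply]

/-- **Every normalised Mie `(2p, p)` chain crystallizes energetically**: `HasPeriodicGroundStateEnergy
(miePotential p) 1` for every natural `p ≥ 3`. [folklore] -/
theorem hasPeriodicGroundStateEnergy_miePotential_one {p : ℕ} (hp : 3 ≤ p) :
    HasPeriodicGroundStateEnergy (miePotential p) 1 := by
  rw [miePotential_eq_mieWith]
  have hp0 : (0 : ℝ) < p := by exact_mod_cast (show 0 < p by omega)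
  exact stub_mieChain _ _ _ _ (by positivity) (by positivity) hp (by omega)

end Summit.AtomisticToContinuum.Crystallization.Theorems.ThreeConeCertificateExactCertificate.Transfer1D

end
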